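import Mathlib.Algebra.Algebra.Bilinear
import Mathlib.Algebra.MvPolynomial.Funext
import Mathlib.Algebra.Ring.Action.End
import Mathlib.GroupTheory.OrderOfElement
import Mathlib.LinearAlgebra.FiniteDimensional.Defs
import Mathlib.LinearAlgebra.Matrix.NonsingularInverse
import Mathlib.LinearAlgebra.Matrix.ToLin
import Literature.RingTheory.GaloisAlgebras.SpeiserLemma
import HarnessLib

/-!
# Hilbert's Theorem 90 for finite-dimensional algebras

Let a finite group `Γ` act faithfully by ring automorphisms on a field `E` whose subfield of
`Γ`-invariants is infinite (automatic in characteristic `0`, `infinite_fixedPoints_of_charZero`),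
and let `R` be a finite-dimensional `E`-algebra.

* `exists_isUnit_forall_eq` — **an invariant unit exists**: for every additive action `ρ` of
  `Γ` on `R` which is semilinear (`ρ_s (e • r) = s(e) • ρ_s r`) some *unit* `b ∈ Rˣ` is
  `ρ`-invariant. By Speiser's lemma (`mem_span_fixedPoints`) `1 = ∑ₗ cₗ wₗ` with invariant
  `wₗ`; the polynomial `P(t) = det (x ↦ (∑ₗ tₗ wₗ) x)` over `E` has `P(c) = 1`, so it has a
  non-zero value at some point `a` with *invariant* coordinates (`MvPolynomial.funext_set`, the
  invariants being infinite), and `b = ∑ₗ aₗ wₗ` is an invariant unit.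
* `hilbert90_algebra` — **`H¹(Γ, Rˣ) = 1`** when `Γ` acts on `R` by ring automorphisms
  compatibly with `E`: every `1`-cocycle `a_{st} = a_s · s(a_t)` of units is a coboundary,
  `a_s = b · s(b)⁻¹` with `b ∈ Rˣ` (apply the first result to the twisted action
  `ρ_s(r) = a_s · s(r)`). For `R = M ⊗_k K` this is Serre, *Local Fields*, Ch. X, §1,
  Exercise 2 (`k` infinite: "use the Poincaré series"); for `R = M_n(K)` it is Speiser's
  `H¹(G, GL_n(K)) = 1` (loc. cit., Prop. 3), and for `R = K` Hilbert's Theorem 90 (Prop. 2; in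
  Mathlib as `groupCohomology.isMulOneCoboundary_of_isMulOneCocycle_of_aut_to_units`).

The finite-field case of Exercise 2 (reduction to semisimple `M` and Lang's theorem) is not
treated. Written for Arthur–Clozel, Ch. 1, Lemma 1.1 (ii), where it is applied to the twisted
centralizer `G_{x,σ}` ("Hilbert's Theorem 90 (cf. [35, Exercise 2, p. 160])").

## References
* J.-P. Serre, *Local Fields*, GTM 67 (1979), Ch. X, §1, Prop. 2, Prop. 3, Exercise 2.
-/

namespace Literature.RingTheory.GaloisAlgebras

open MvPolynomial

section FixedScalars

variable (Γ E : Type*) [Monoid Γ] [Semiring E] [MulSemiringAction Γ E]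

/-- In characteristic `0` the invariants of any action by (semi)ring homomorphisms contain the
natural numbers, so they form an infinite set. [folklore] -/
theorem infinite_fixedPoints_of_charZero [CharZero E] :
    {e : E | ∀ s : Γ, s • e = e}.Infinite := by
  refine (Set.infinite_range_of_injective (Nat.cast_injective (R := E))).mono ?_
  rintro _ ⟨n, rfl⟩ s
  have h := map_natCast (MulSemiringAction.toRingHom Γ E s) n
  rwa [MulSemiringAction.toRingHom_apply] at h

end FixedScalars

section InvariantUnit

variable {Γ E R : Type*} [Group Γ] [Fintype Γ] [Field E] [MulSemiringAction Γ E]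
  [FaithfulSMul Γ E] [Ring R] [Algebra E R] [FiniteDimensional E R]

/-- Evaluating the generic combination `∑ₗ tₗ Tₗ` of matrices (indeterminate coefficients) at a
point `x` gives `∑ₗ xₗ Tₗ`. [folklore] -/
private theorem det_eval_sum_X_smul {ι : Type*} [Fintype ι] [DecidableEq ι] {t : ℕ}
    (T : Fin t → Matrix ι ι E) (x : Fin t → E) :
    MvPolynomial.eval x
        (∑ l, (MvPolynomial.X l : MvPolynomial (Fin t) E) • (T l).map MvPolynomial.C).det =
      (∑ l, x l • T l).det := by
  rw [RingHom.map_det]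
  congr 1
  ext i j
  simp [Matrix.sum_apply]

/-- **A semilinear action on a finite-dimensional algebra has an invariant unit.** Let the
finite group `Γ` act faithfully by ring automorphisms on the field `E`, with infinitely many
invariant scalars, and additively and semilinearly (`ρ_s (e • r) = s(e) • ρ_s r`) on the
finite-dimensional `E`-algebra `R` (no compatibility with the multiplication of `R` is
required). Then some unit of `R` is fixed by every `ρ_s`. Proof: `1 ∈ R` is an `E`-combination
`∑ₗ cₗ wₗ` of invariant vectors (Speiser, `mem_span_fixedPoints`); the determinant of left
multiplication by `∑ₗ tₗ wₗ` is a polynomial over `E` with value `1` at `t = c`, hence non-zero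
at some `t = a` with invariant coordinates (`MvPolynomial.funext_set`); `∑ₗ aₗ wₗ` is an
invariant unit — the "Poincaré series" argument of Serre, *Local Fields*, Ch. X, §1, proof of
Prop. 3 and Exercise 2 (infinite case). [cite: SerreLocalFields1979, Ch. X, §1, Exercise 2] -/
theorem exists_isUnit_forall_eq (hinf : {e : E | ∀ s : Γ, s • e = e}.Infinite)
    (ρ : Γ →* AddMonoid.End R) (hρ : ∀ (s : Γ) (e : E) (r : R), ρ s (e • r) = (s • e) • ρ s r) :
    ∃ b : R, IsUnit b ∧ ∀ s : Γ, ρ s b = b := by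
  classical
  -- Speiser: `1` is a combination of invariant vectors `w l`
  obtain ⟨t, c, w, hcw⟩ := Submodule.mem_span_set'.mp (mem_span_fixedPoints ρ hρ (1 : R))
  have hw : ∀ l s, ρ s (w l : R) = w l := fun l s => (w l).2 s
  -- left multiplications as matrices
  let bR := Module.finBasis E R
  let T : Fin t → Matrix (Fin (Module.finrank E R)) (Fin (Module.finrank E R)) E :=
    fun l => LinearMap.toMatrixAlgEquiv bR (Algebra.lmul E R (w l : R))
  have hT : ∀ x : Fin t → E,
      ∑ l, x l • T l = LinearMap.toMatrixAlgEquiv bR (Algebra.lmul E R (∑ l, x l • (w l : R))) := by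
    intro x
    simp only [T, map_sum, map_smul]
  -- the determinant polynomial and its value `1` at `c`
  obtain ⟨P, hPdef⟩ : ∃ P : MvPolynomial (Fin t) E,
      P = (∑ l, (MvPolynomial.X l : MvPolynomial (Fin t) E) • (T l).map MvPolynomial.C).det :=
    ⟨_, rfl⟩
  have hPc : MvPolynomial.eval c P = 1 := by
    rw [hPdef, det_eval_sum_X_smul, hT, hcw, map_one, map_one, Matrix.det_one]
  -- a point with invariant coordinates where `P` does not vanish
  obtain ⟨a, ha, hPa⟩ : ∃ a : Fin t → E, (∀ l s, s • a l = a l) ∧ MvPolynomial.eval a P ≠ 0 := by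
    by_contra! hall
    have hP0 : P = 0 :=
      MvPolynomial.funext_set (fun _ : Fin t => {e : E | ∀ s : Γ, s • e = e}) (fun _ => hinf)
        fun x hx => by
          rw [map_zero]
          exact hall x fun l s => hx l (Set.mem_univ l) s
    rw [hP0, map_zero] at hPc
    exact zero_ne_one hPc
  refine ⟨∑ l, a l • (w l : R), ?_, fun s => ?_⟩
  · -- unit: left multiplication has invertible matrix
    rw [← Algebra.lmul_isUnit_iff (R := E), ← MulEquiv.isUnit_map (LinearMap.toMatrixAlgEquiv bR),
      ← hT, Matrix.isUnit_iff_isUnit_det, ← det_eval_sum_X_smul, isUnit_iff_ne_zero, ← hPdef]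
    exact hPa
  · simp only [map_sum, hρ, ha, hw]

end InvariantUnit

section Cocycle

variable {Γ E R : Type*} [Group Γ] [Fintype Γ] [Field E] [MulSemiringAction Γ E]
  [FaithfulSMul Γ E] [Ring R] [Algebra E R] [FiniteDimensional E R] [MulSemiringAction Γ R]

/-- **Hilbert's Theorem 90 for a finite-dimensional algebra (`H¹(Γ, Rˣ) = 1`).** Let the finite
group `Γ` act faithfully by ring automorphisms on the field `E`, with infinitely many invariant
scalars (e.g. `char E = 0`, `infinite_fixedPoints_of_charZero`), and by ring automorphisms on
the finite-dimensional `E`-algebra `R`, compatibly: `s(e • r) = s(e) • s(r)`. Then every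
`1`-cocycle of units, `a_{st} = a_s · s(a_t)`, is a coboundary: `a_s · s(b) = b` for a unit
`b`, i.e. `a_s = b · s(b)⁻¹`. Apply `exists_isUnit_forall_eq` to the twisted semilinear action
`ρ_s(r) = a_s · s(r)` (Serre, *Local Fields*, Ch. X, §1, Exercise 2, for `R = M ⊗_k K` and `k`
infinite; Prop. 3 for `R = M_n`). [cite: SerreLocalFields1979, Ch. X, §1, Exercise 2] -/
theorem hilbert90_algebra (hinf : {e : E | ∀ s : Γ, s • e = e}.Infinite)
    (hcompat : ∀ (s : Γ) (e : E) (r : R), s • (e • r) = (s • e) • s • r)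
    (a : Γ → R) (hau : ∀ s, IsUnit (a s)) (ha : ∀ s t, a (s * t) = a s * s • a t) :
    ∃ b : R, IsUnit b ∧ ∀ s : Γ, a s * s • b = b := by
  -- `a 1 = 1`
  have ha1 : a 1 = 1 := by
    have h := ha 1 1
    rw [mul_one, one_smul] at h
    have h2 : a 1 * 1 = a 1 * a 1 := by rw [mul_one]; exact h
    exact ((hau 1).mul_right_injective h2).symm
  -- the twisted action `ρ_s (r) = a_s · s(r)`
  let ρ : Γ →* AddMonoid.End R :=
    { toFun := fun s => (AddMonoidHom.mulLeft (a s)).comp (DistribSMul.toAddMonoidHom R s)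
      map_one' := by
        ext r
        show a 1 * (1 : Γ) • r = r
        rw [ha1, one_smul, one_mul]
      map_mul' := fun s t => by
        ext r
        show a (s * t) * (s * t) • r = a s * s • (a t * t • r)
        rw [ha, mul_smul, smul_mul', mul_assoc] }
  have hρapply : ∀ (s : Γ) (r : R), ρ s r = a s * s • r := fun _ _ => rfl
  have hρ : ∀ (s : Γ) (e : E) (r : R), ρ s (e • r) = (s • e) • ρ s r := fun s e r => by
    rw [hρapply, hρapply, hcompat, mul_smul_comm]
  obtain ⟨b, hb, hfix⟩ := exists_isUnit_forall_eq hinf ρ hρ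
  exact ⟨b, hb, fun s => by rw [← hρapply]; exact hfix s⟩

end Cocycle

section Cyclic

variable {E R : Type*} [Field E] [Ring R] [Algebra E R] [FiniteDimensional E R]

omit [FiniteDimensional E R] in
/-- Powers of a `σ`-semilinear ring endomorphism `τ` are `σ^k`-semilinear. [folklore] -/
private theorem pow_apply_smul (σ : RingAut E) (τ : R →+* R)
    (hτ : ∀ (e : E) (r : R), τ (e • r) = σ e • τ r) (k : ℕ) (e : E) (r : R) :
    (τ ^ k) (e • r) = (σ ^ k) e • (τ ^ k) r := by
  induction k generalizing e r with
  | zero => simp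
  | succ k ih => rw [pow_succ, pow_succ, RingHom.coe_mul, Function.comp_apply, hτ, ih]; rfl

/-- The partial twisted norms `a_k = z · τ(z) ⋯ τ^{k-1}(z)` satisfy the cocycle identity
`a_{j+k} = a_j · τ^j(a_k)`. [folklore] -/
private theorem prod_range_add (τ : R →+* R) (z : R) (j k : ℕ) :
    ((List.range (j + k)).map fun i => (τ ^ i) z).prod =
      ((List.range j).map fun i => (τ ^ i) z).prod *
        (τ ^ j) ((List.range k).map fun i => (τ ^ i) z).prod := by
  induction k with
  | zero => simp
  | succ k ih =>
    rw [← add_assoc, List.prod_range_succ, ih, List.prod_range_succ, map_mul, mul_assoc,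
      pow_add, RingHom.coe_mul, Function.comp_apply]

/-- **Hilbert's Theorem 90 for a finite-dimensional algebra, cyclic form.** Let `σ` be an
automorphism of finite order `ℓ` of the field `E` with infinitely many fixed points (e.g.
`char E = 0`, `hilbert90_cyclic_of_charZero`), `R` a finite-dimensional `E`-algebra and
`τ : R → R` a ring endomorphism which is `σ`-semilinear (`τ(e • r) = σ(e) • τ(r)`) with
`τ^ℓ = 1`. If `z ∈ R` has twisted norm `z · τ(z) ⋯ τ^{ℓ-1}(z) = 1`, then `z · τ(b) = b` for some
unit `b ∈ Rˣ`, i.e. `z = b · τ(b)⁻¹`. This is `hilbert90_algebra` / `exists_isUnit_forall_eq` for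
the cyclic group `⟨σ⟩ ≤ Aut(E)` acting on `R` through the twisted action
`σ^k ↦ (r ↦ a_k · τ^k(r))`, `a_k = z τ(z) ⋯ τ^{k-1}(z)` (Serre, *Local Fields*, Ch. X, §1,
Exercise 2 with the Corollary to Prop. 2 (cyclic case)). [cite: SerreLocalFields1979, Ch. X, §1, Exercise 2] -/
theorem hilbert90_cyclic (σ : RingAut E) (hσ : IsOfFinOrder σ)
    (hinf : {e : E | σ e = e}.Infinite) (τ : R →+* R)
    (hτ : ∀ (e : E) (r : R), τ (e • r) = σ e • τ r) (hτℓ : τ ^ orderOf σ = 1) {z : R}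
    (hN : ((List.range (orderOf σ)).map fun i => (τ ^ i) z).prod = 1) :
    ∃ b : R, IsUnit b ∧ z * τ b = b := by
  classical
  set ℓ := orderOf σ with hℓdef
  have hℓ : 0 < ℓ := hσ.orderOf_pos
  -- partial twisted norms and their periodicity
  let a : ℕ → R := fun k => ((List.range k).map fun i => (τ ^ i) z).prod
  have ha_add : ∀ j k, a (j + k) = a j * (τ ^ j) (a k) := fun j k => prod_range_add τ z j k
  have ha_per : ∀ q m, a (m + ℓ * q) = a m := by
    intro q
    induction q with
    | zero => simp
    | succ q ih =>
      intro m
      rw [Nat.mul_succ, ← add_assoc, ha_add, ih, show a ℓ = 1 from hN, map_one, mul_one]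
  have hτ_per : ∀ q m, τ ^ (m + ℓ * q) = τ ^ m := fun q m => by
    rw [pow_add, pow_mul, hτℓ, one_pow, mul_one]
  have ha_mod : ∀ n, a n = a (n % ℓ) := fun n => by
    conv_lhs => rw [← Nat.mod_add_div n ℓ]
    exact ha_per _ _
  have hτ_mod : ∀ n, τ ^ n = τ ^ (n % ℓ) := fun n => by
    conv_lhs => rw [← Nat.mod_add_div n ℓ]
    exact hτ_per _ _
  -- the cyclic group `Γ = ⟨σ⟩` and the exponent of each of its elements
  let Γ := Subgroup.zpowers σ
  letI : Fintype Γ := Fintype.ofEquiv _ (finEquivZPowers hσ)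
  let k : Γ → ℕ := fun g => ((finEquivZPowers hσ).symm g : ℕ)
  have hk_lt : ∀ g, k g < ℓ := fun g => ((finEquivZPowers hσ).symm g).2
  have hk : ∀ g : Γ, (g : RingAut E) = σ ^ k g := fun g =>
    (pow_finEquivZPowers_symm_apply hσ g).symm
  have hk_mul : ∀ g h : Γ, k (g * h) = (k g + k h) % ℓ := fun g h => by
    have hmod : k (g * h) ≡ k g + k h [MOD ℓ] := by
      rw [hℓdef, ← pow_eq_pow_iff_modEq, pow_add, ← hk, ← hk, ← hk]
      rfl
    rw [← Nat.mod_eq_of_lt (hk_lt (g * h))]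
    exact hmod
  have hk_one : k 1 = 0 := by
    have hmod : k 1 ≡ 0 [MOD ℓ] := by
      rw [hℓdef, ← pow_eq_pow_iff_modEq, pow_zero, ← hk]
      rfl
    rw [← Nat.mod_eq_of_lt (hk_lt 1), hmod, Nat.zero_mod]
  -- the twisted action `ρ (σ^k) r = a_k · τ^k r`
  let ρ : Γ →* AddMonoid.End R :=
    { toFun := fun g => (AddMonoidHom.mulLeft (a (k g))).comp (τ ^ k g).toAddMonoidHom
      map_one' := by
        ext r
        show a (k 1) * (τ ^ k 1) r = r
        rw [hk_one, pow_zero, RingHom.coe_one, id_eq]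
        simp [a]
      map_mul' := fun g h => by
        ext r
        change a (k (g * h)) * (τ ^ k (g * h)) r = a (k g) * (τ ^ k g) (a (k h) * (τ ^ k h) r)
        rw [hk_mul, ← ha_mod, ← hτ_mod, ha_add, map_mul, pow_add, RingHom.coe_mul,
          Function.comp_apply, mul_assoc] }
  have hρapply : ∀ (g : Γ) (r : R), ρ g r = a (k g) * (τ ^ k g) r := fun _ _ => rfl
  have hsmul : ∀ (g : Γ) (e : E), g • e = (σ ^ k g) e := fun g e => by
    rw [Subgroup.smul_def, hk]
    rfl
  have hρ : ∀ (g : Γ) (e : E) (r : R), ρ g (e • r) = (g • e) • ρ g r := fun g e r => by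
    rw [hρapply, hρapply, pow_apply_smul σ τ hτ, hsmul, mul_smul_comm]
  -- the invariant scalars of `Γ` contain the fixed points of `σ`
  have hinf' : {e : E | ∀ g : Γ, g • e = e}.Infinite := by
    refine hinf.mono fun e (he : σ e = e) g => ?_
    rw [hsmul, RingAut.coe_pow]
    exact Function.iterate_fixed he _
  obtain ⟨b, hb, hfix⟩ := exists_isUnit_forall_eq hinf' ρ hρ
  by_cases hℓ1 : ℓ = 1
  · -- `σ = 1`: then `z = a 1 = 1` and `b = 1` works
    refine ⟨1, isUnit_one, ?_⟩
    have hz : z = 1 := by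
      have h1 : a 1 = 1 := hℓ1 ▸ hN
      simpa [a] using h1
    rw [hz, map_one, one_mul]
  · -- read off the invariance under `σ` itself: `a 1 · τ b = z · τ b = b`
    have h1ℓ : 1 < ℓ := lt_of_le_of_ne hℓ (Ne.symm hℓ1)
    refine ⟨b, hb, ?_⟩
    have hg := hfix (finEquivZPowers hσ ⟨1, h1ℓ⟩)
    rw [hρapply] at hg
    have hk1 : k (finEquivZPowers hσ ⟨1, h1ℓ⟩) = 1 := by
      simp only [k, Equiv.symm_apply_apply]
    rw [hk1] at hg
    simpa [a] using hg

/-- **Hilbert's Theorem 90 for a finite-dimensional algebra over a field of characteristic `0`,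
cyclic form**: as `hilbert90_cyclic`, the fixed points of `σ` being infinite because they
contain `ℕ`. [cite: SerreLocalFields1979, Ch. X, §1, Exercise 2] -/
theorem hilbert90_cyclic_of_charZero [CharZero E] (σ : RingAut E) (hσ : IsOfFinOrder σ)
    (τ : R →+* R) (hτ : ∀ (e : E) (r : R), τ (e • r) = σ e • τ r) (hτℓ : τ ^ orderOf σ = 1)
    {z : R} (hN : ((List.range (orderOf σ)).map fun i => (τ ^ i) z).prod = 1) :
    ∃ b : R, IsUnit b ∧ z * τ b = b :=
  hilbert90_cyclic σ hσ
    ((Set.infinite_range_of_injective (Nat.cast_injective (R := E))).mono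
      (by rintro _ ⟨n, rfl⟩; exact map_natCast σ n))
    τ hτ hτℓ hN

end Cyclic

end Literature.RingTheory.GaloisAlgebras
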